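import Mathlib

/-!
# SoloInformedSliceIdentity — the slice identity for the located window of a product system

Solo unit `solo-Parity-informed` (ideation tier, informed mode), session 136; `paper.md`
Remark 20.11 (ii)/(iv) ([R] → [K]), `PLAN.md` §101.5 item Q2, CLAIMS C214.

Let `F = G · H` with `G, H ∈ ℤ[X]` and let `R ≥ 1` be an integer such that every prime dividing
both `G(n)` and `H(n)` for some `n` divides `R` — for instance `R = |Res(G, H)|`, or any `R` with a
Bézout identity `A·G + B·H = R` in `ℤ[X]` (`primeCollision_of_bezout`).  Then for every `n`:

* (`filter_dvd_mul_slice_eq`) among the moduli `e` prime to `R`, the divisors `e` of `F(n)` with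
  `(e, H(n)) = 1` are EXACTLY the divisors of `G(n)`:
  `{e ∈ S : e ∣ G(n)H(n), (e,R) = 1, (e,H(n)) = 1} = {e ∈ S : e ∣ G(n), (e,R) = 1}`;
* (`eq_gcd_mul_gcd_of_dvd_mul`, `eq_gcd_of_mul_eq`) every `e ∣ F(n)` with `(e,R) = 1` factors
  UNIQUELY as `e = e′·e″` with `e′ ∣ G(n)`, `e″ ∣ H(n)`, namely `e′ = (e, G(n))`, `e″ = (e, H(n))`,
  and `(e′, e″) = 1`.

Consequently (`sliceSum_eq`, `tailSlice_eq`) for every weight `w`, every window and every `x`,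
the `e″ = 1` slice of the located window of the system `F = G·H` over moduli prime to `R`,
`∑_{n ≤ x} ∑_{e ∣ F(n), e ∈ window, (e,R)=1, (e,H(n))=1} w(e)`, equals the located window of the
single factor `G` over moduli prime to `R`, `∑_{n ≤ x} ∑_{e ∣ G(n), e ∈ window, (e,R)=1} w(e)`.

Instances (Remark 20.11): for the Bateman–Horn system `(X, X²+X+1)` one may take `R = 1`
(`(X²+X+1) − (X+1)·X = 1`), so the slice `(e, n) = 1` of the window of `n(n²+n+1)` is LITERALLY the
located window of `n²+n+1` (`slice_X_sq_add_X_add_one`); for `(X, X+2, X+6)` sliced along `X+6`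
one may take `R = 24` (`X(X+2) + (4−X)(X+6) = 24`), and the slice `(e, n+6) = 1`, `(e, 6) = 1` of the
window of `n(n+2)(n+6)` is the pair window of `n(n+2)` over moduli prime to `6`
(`slice_twin_add_six`).  Everything here is elementary and exact; no estimate is claimed.
-/

namespace Summit.Parity.BatemanHorn.Theorems

open Finset Polynomial
open scoped ArithmeticFunction.Moebius

/-! ### Values: two integers `a, b` whose common prime divisors all divide `R` -/

/-- If every common prime divisor of `a` and `b` divides `R`, then a divisor `e` of `a` prime to
`R` is prime to `b`. [this work] -/
theorem coprime_natAbs_of_dvd_of_coprime {a b : ℤ} {R e : ℕ}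
    (hcol : ∀ p : ℕ, p.Prime → (p : ℤ) ∣ a → (p : ℤ) ∣ b → p ∣ R)
    (he : (e : ℤ) ∣ a) (hR : e.Coprime R) : e.Coprime b.natAbs := by
  refine Nat.coprime_of_dvd fun p hp hpe hpb => ?_
  have hpa : (p : ℤ) ∣ a := (Int.natCast_dvd_natCast.mpr hpe).trans he
  have hpb' : (p : ℤ) ∣ b := Int.natCast_dvd.mpr hpb
  exact hp.one_lt.ne' ((Nat.Coprime.coprime_dvd_left hpe hR).eq_one_of_dvd (hcol p hp hpa hpb'))

/-- **Slice identity for values.**  If every common prime divisor of `a` and `b` divides `R`,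
then in any finite set `S` of moduli, the `e` prime to `R` dividing `a·b` and prime to `b` are
exactly the `e` prime to `R` dividing `a`. [this work] -/
theorem filter_dvd_mul_slice_eq {a b : ℤ} {R : ℕ}
    (hcol : ∀ p : ℕ, p.Prime → (p : ℤ) ∣ a → (p : ℤ) ∣ b → p ∣ R) (S : Finset ℕ) :
    S.filter (fun e : ℕ => (e : ℤ) ∣ a * b ∧ e.Coprime R ∧ e.Coprime b.natAbs)
      = S.filter (fun e : ℕ => (e : ℤ) ∣ a ∧ e.Coprime R) := by
  ext e
  simp only [mem_filter]
  constructor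
  · rintro ⟨hS, hab, hR, hb⟩
    refine ⟨hS, ?_, hR⟩
    have h1 : e ∣ a.natAbs * b.natAbs := by
      rw [← Int.natAbs_mul]; exact Int.natCast_dvd.mp hab
    exact Int.natCast_dvd.mpr (hb.dvd_of_dvd_mul_right h1)
  · rintro ⟨hS, ha, hR⟩
    exact ⟨hS, ha.trans (dvd_mul_right a b), hR, coprime_natAbs_of_dvd_of_coprime hcol ha hR⟩

/-- **Slice identity for values, divisor form.**  For `a·b ≠ 0` and any side condition `P`:
the divisors `e` of `|a·b|` with `P e`, `(e,R) = 1`, `(e,|b|) = 1` are exactly the divisors of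
`|a|` with `P e`, `(e,R) = 1`. [this work] -/
theorem divisors_filter_slice_eq {a b : ℤ} {R : ℕ}
    (hcol : ∀ p : ℕ, p.Prime → (p : ℤ) ∣ a → (p : ℤ) ∣ b → p ∣ R) (hab : a * b ≠ 0)
    (P : ℕ → Prop) [DecidablePred P] :
    (a * b).natAbs.divisors.filter (fun e => P e ∧ e.Coprime R ∧ e.Coprime b.natAbs)
      = a.natAbs.divisors.filter (fun e => P e ∧ e.Coprime R) := by
  have ha : a ≠ 0 := left_ne_zero_of_mul hab
  ext e
  simp only [mem_filter, Nat.mem_divisors, ne_eq, Int.natAbs_eq_zero]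
  constructor
  · rintro ⟨⟨hd, -⟩, hP, hR, hb⟩
    refine ⟨⟨?_, ha⟩, hP, hR⟩
    rw [Int.natAbs_mul] at hd
    exact hb.dvd_of_dvd_mul_right hd
  · rintro ⟨⟨hd, -⟩, hP, hR⟩
    refine ⟨⟨?_, hab⟩, hP, hR, ?_⟩
    · rw [Int.natAbs_mul]; exact hd.trans (dvd_mul_right _ _)
    · exact coprime_natAbs_of_dvd_of_coprime hcol (Int.natCast_dvd.mpr hd) hR

/-- The two slices `(e,|a|)` and `(e,|b|)` of a modulus `e` prime to `R` are coprime.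
[this work] -/
theorem coprime_gcd_natAbs_gcd_natAbs {a b : ℤ} {R e : ℕ}
    (hcol : ∀ p : ℕ, p.Prime → (p : ℤ) ∣ a → (p : ℤ) ∣ b → p ∣ R) (hR : e.Coprime R) :
    (Nat.gcd e a.natAbs).Coprime (Nat.gcd e b.natAbs) := by
  refine Nat.coprime_of_dvd fun p hp hpu hpv => ?_
  have hpe : p ∣ e := hpu.trans (Nat.gcd_dvd_left _ _)
  have hpa : (p : ℤ) ∣ a := Int.natCast_dvd.mpr (hpu.trans (Nat.gcd_dvd_right _ _))
  have hpb : (p : ℤ) ∣ b := Int.natCast_dvd.mpr (hpv.trans (Nat.gcd_dvd_right _ _))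
  exact hp.one_lt.ne' ((Nat.Coprime.coprime_dvd_left hpe hR).eq_one_of_dvd (hcol p hp hpa hpb))

/-- **Uniqueness of the slice factorisation.**  If `e = u·v` with `u ∣ a`, `v ∣ b` and `e` prime
to `R`, then `u = (e,|a|)` and `v = (e,|b|)`. [this work] -/
theorem eq_gcd_of_mul_eq {a b : ℤ} {R e u v : ℕ}
    (hcol : ∀ p : ℕ, p.Prime → (p : ℤ) ∣ a → (p : ℤ) ∣ b → p ∣ R) (hR : e.Coprime R)
    (hu : (u : ℤ) ∣ a) (hv : (v : ℤ) ∣ b) (huv : u * v = e) :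
    u = Nat.gcd e a.natAbs ∧ v = Nat.gcd e b.natAbs := by
  have hue : u ∣ e := ⟨v, huv.symm⟩
  have hve : v ∣ e := ⟨u, by rw [mul_comm]; exact huv.symm⟩
  have hu' : u ∣ a.natAbs := Int.natCast_dvd.mp hu
  have hv' : v ∣ b.natAbs := Int.natCast_dvd.mp hv
  have hga : Nat.gcd e a.natAbs ∣ u := by
    have h1 : Nat.gcd e a.natAbs ∣ u * v := by rw [huv]; exact Nat.gcd_dvd_left _ _
    have h2 : (Nat.gcd e a.natAbs).Coprime v := by
      refine Nat.coprime_of_dvd fun p hp hpg hpv => ?_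
      have hpa : (p : ℤ) ∣ a := Int.natCast_dvd.mpr (hpg.trans (Nat.gcd_dvd_right _ _))
      have hpb : (p : ℤ) ∣ b := (Int.natCast_dvd_natCast.mpr hpv).trans hv
      have hpe : p ∣ e := hpg.trans (Nat.gcd_dvd_left _ _)
      exact hp.one_lt.ne'
        ((Nat.Coprime.coprime_dvd_left hpe hR).eq_one_of_dvd (hcol p hp hpa hpb))
    exact h2.dvd_of_dvd_mul_right h1
  have hgb : Nat.gcd e b.natAbs ∣ v := by
    have h1 : Nat.gcd e b.natAbs ∣ u * v := by rw [huv]; exact Nat.gcd_dvd_left _ _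
    have h2 : (Nat.gcd e b.natAbs).Coprime u := by
      refine Nat.coprime_of_dvd fun p hp hpg hpu => ?_
      have hpb : (p : ℤ) ∣ b := Int.natCast_dvd.mpr (hpg.trans (Nat.gcd_dvd_right _ _))
      have hpa : (p : ℤ) ∣ a := (Int.natCast_dvd_natCast.mpr hpu).trans hu
      have hpe : p ∣ e := hpg.trans (Nat.gcd_dvd_left _ _)
      exact hp.one_lt.ne'
        ((Nat.Coprime.coprime_dvd_left hpe hR).eq_one_of_dvd (hcol p hp hpa hpb))
    exact h2.dvd_of_dvd_mul_left h1
  exact ⟨Nat.dvd_antisymm (Nat.dvd_gcd hue hu') hga, Nat.dvd_antisymm (Nat.dvd_gcd hve hv') hgb⟩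

/-- **Existence of the slice factorisation.**  Every `e ∣ a·b` prime to `R` is the product of its
two slices: `e = (e,|a|)·(e,|b|)`. [this work] -/
theorem eq_gcd_mul_gcd_of_dvd_mul {a b : ℤ} {R e : ℕ}
    (hcol : ∀ p : ℕ, p.Prime → (p : ℤ) ∣ a → (p : ℤ) ∣ b → p ∣ R)
    (he : (e : ℤ) ∣ a * b) (hR : e.Coprime R) :
    e = Nat.gcd e a.natAbs * Nat.gcd e b.natAbs := by
  have h1 : e ∣ a.natAbs * b.natAbs := by
    rw [← Int.natAbs_mul]; exact Int.natCast_dvd.mp he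
  obtain ⟨u, v, hu, hv, huv⟩ := Nat.dvd_mul.mp h1
  obtain ⟨hu', hv'⟩ :=
    eq_gcd_of_mul_eq hcol hR (Int.natCast_dvd.mpr hu) (Int.natCast_dvd.mpr hv) huv
  subst hu' hv'
  exact huv.symm

/-! ### Polynomials: a Bézout identity bounds the prime collisions -/

/-- A Bézout identity `A(n)G(n) + B(n)H(n) = R` (e.g. from `A·G + B·H = R` in `ℤ[X]`, `R` a
non-zero multiple of the resultant) forces every common prime divisor of `G(n)` and `H(n)` to
divide `R`. [this work] -/
theorem primeCollision_of_bezout {G H A B : ℤ[X]} {R : ℕ}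
    (h : ∀ n : ℤ, A.eval n * G.eval n + B.eval n * H.eval n = R) (n : ℤ) (p : ℕ)
    (hG : (p : ℤ) ∣ G.eval n) (hH : (p : ℤ) ∣ H.eval n) : p ∣ R := by
  have h2 : (p : ℤ) ∣ (R : ℤ) := by
    rw [← h n]; exact dvd_add (dvd_mul_of_dvd_right hG _) (dvd_mul_of_dvd_right hH _)
  exact Int.natCast_dvd_natCast.mp h2

/-- **Slice identity for the located window of a product system** (Remark 20.11 (ii)).  For
`F = G·H` and `R` bounding the prime collisions of `G` and `H`: for every finite window `S` of
moduli, every weight `w` and every `x`, the slice `(e, H(n)) = 1` of the window of `F` over moduli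
prime to `R` equals the window of `G` alone over moduli prime to `R`. [this work] -/
theorem sliceSum_eq {G H : ℤ[X]} {R : ℕ}
    (hcol : ∀ n : ℤ, ∀ p : ℕ, p.Prime → (p : ℤ) ∣ G.eval n → (p : ℤ) ∣ H.eval n → p ∣ R)
    (S : Finset ℕ) (w : ℕ → ℝ) (x : ℕ) :
    ∑ n ∈ Icc 1 x, ∑ e ∈ S.filter (fun e : ℕ => (e : ℤ) ∣ (G * H).eval (n : ℤ) ∧ e.Coprime R ∧
        e.Coprime (H.eval (n : ℤ)).natAbs), w e
      = ∑ n ∈ Icc 1 x, ∑ e ∈ S.filter (fun e : ℕ => (e : ℤ) ∣ G.eval (n : ℤ) ∧ e.Coprime R),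
        w e := by
  refine sum_congr rfl fun n _ => ?_
  rw [eval_mul, filter_dvd_mul_slice_eq (hcol (n : ℤ)) S]

/-- **Slice identity, divisor-tail form** (the shape of the large-divisor tail in
`SoloInformedBatemanHornLocalisation`).  For `F = G·H` non-vanishing on `[1,x]`-integers and `R`
bounding the prime collisions: the slice `(e, H(n)) = 1`, `(e, R) = 1` of
`∑_{n ≤ x} ∑_{e ∣ F(n), P e} w(e)` is `∑_{n ≤ x} ∑_{e ∣ G(n), P e, (e,R) = 1} w(e)`. [this work] -/
theorem tailSlice_eq {G H : ℤ[X]} {R : ℕ}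
    (hcol : ∀ n : ℤ, ∀ p : ℕ, p.Prime → (p : ℤ) ∣ G.eval n → (p : ℤ) ∣ H.eval n → p ∣ R)
    (hz : ∀ n : ℕ, 1 ≤ n → (G * H).eval (n : ℤ) ≠ 0)
    (P : ℕ → Prop) [DecidablePred P] (w : ℕ → ℝ) (x : ℕ) :
    ∑ n ∈ Icc 1 x, ∑ e ∈ (((G * H).eval (n : ℤ)).natAbs.divisors.filter
        fun e => P e ∧ e.Coprime R ∧ e.Coprime (H.eval (n : ℤ)).natAbs), w e
      = ∑ n ∈ Icc 1 x, ∑ e ∈ ((G.eval (n : ℤ)).natAbs.divisors.filter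
        fun e => P e ∧ e.Coprime R), w e := by
  refine sum_congr rfl fun n hn => ?_
  have hn1 : 1 ≤ n := (mem_Icc.mp hn).1
  have hne : G.eval (n : ℤ) * H.eval (n : ℤ) ≠ 0 := by rw [← eval_mul]; exact hz n hn1
  rw [eval_mul, divisors_filter_slice_eq (hcol (n : ℤ)) hne P]

/-! ### The two instances of Remark 20.11 -/

/-- Bézout for `(X²+X+1, X)`: `1·(n²+n+1) + (−(n+1))·n = 1`. [this work] -/
theorem bezout_X_sq_add_X_add_one (n : ℤ) :
    (1 : ℤ[X]).eval n * (X ^ 2 + X + 1 : ℤ[X]).eval n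
      + (-(X + 1) : ℤ[X]).eval n * (X : ℤ[X]).eval n = ((1 : ℕ) : ℤ) := by
  simp only [eval_one, eval_add, eval_pow, eval_X, eval_neg, Nat.cast_one]
  ring

/-- `n(n²+n+1) ≠ 0` for `n ≥ 1`. [this work] -/
theorem eval_X_sq_add_X_add_one_mul_X_ne_zero (n : ℕ) (hn : 1 ≤ n) :
    ((X ^ 2 + X + 1 : ℤ[X]) * X).eval (n : ℤ) ≠ 0 := by
  simp only [eval_mul, eval_add, eval_pow, eval_X, eval_one]
  have h1 : (0 : ℤ) < n := by exact_mod_cast hn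
  positivity

/-- **Remark 20.11 (ii), the system `(X, X²+X+1)`.**  The slice `(e, n) = 1` of the located
window `∑_{n ≤ x} ∑_{e ∣ n(n²+n+1), e > y} μ(e) log² e` is LITERALLY the located window of
`n²+n+1`: `∑_{n ≤ x} ∑_{e ∣ n²+n+1, e > y} μ(e) log² e` (here `R = 1`). [this work] -/
theorem slice_X_sq_add_X_add_one (x y : ℕ) :
    ∑ n ∈ Icc 1 x, ∑ e ∈ ((((X ^ 2 + X + 1 : ℤ[X]) * X).eval (n : ℤ)).natAbs.divisors.filter
        fun e => y < e ∧ e.Coprime n), (μ e : ℝ) * Real.log e ^ 2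
      = ∑ n ∈ Icc 1 x, ∑ e ∈ (((X ^ 2 + X + 1 : ℤ[X]).eval (n : ℤ)).natAbs.divisors.filter
        fun e => y < e), (μ e : ℝ) * Real.log e ^ 2 := by
  have hcol : ∀ n : ℤ, ∀ p : ℕ, p.Prime → (p : ℤ) ∣ (X ^ 2 + X + 1 : ℤ[X]).eval n →
      (p : ℤ) ∣ (X : ℤ[X]).eval n → p ∣ 1 :=
    fun n p _ hG hH => primeCollision_of_bezout bezout_X_sq_add_X_add_one n p hG hH
  have h := tailSlice_eq hcol eval_X_sq_add_X_add_one_mul_X_ne_zero (fun e => y < e)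
    (fun e => (μ e : ℝ) * Real.log e ^ 2) x
  have hL : ∀ n : ℕ, ((((X ^ 2 + X + 1 : ℤ[X]) * X).eval (n : ℤ)).natAbs.divisors.filter
        fun e => y < e ∧ e.Coprime n)
      = ((((X ^ 2 + X + 1 : ℤ[X]) * X).eval (n : ℤ)).natAbs.divisors.filter
        fun e => y < e ∧ e.Coprime 1 ∧ e.Coprime ((X : ℤ[X]).eval (n : ℤ)).natAbs) := by
    intro n
    refine filter_congr fun e _ => ?_
    simp only [eval_X, Int.natAbs_natCast, Nat.coprime_one_right_eq_true, true_and]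
  have hR : ∀ n : ℕ, (((X ^ 2 + X + 1 : ℤ[X]).eval (n : ℤ)).natAbs.divisors.filter
        fun e => y < e)
      = (((X ^ 2 + X + 1 : ℤ[X]).eval (n : ℤ)).natAbs.divisors.filter
        fun e => y < e ∧ e.Coprime 1) := by
    intro n
    refine filter_congr fun e _ => ?_
    simp only [Nat.coprime_one_right_eq_true, and_true]
  simp_rw [hL, hR]
  exact h

/-- Bézout for `(X(X+2), X+6)`: `1·n(n+2) + (4−n)(n+6) = 24`. [this work] -/
theorem bezout_twin_add_six (n : ℤ) :
    (1 : ℤ[X]).eval n * (X * (X + 2) : ℤ[X]).eval n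
      + ((4 : ℤ[X]) - X).eval n * (X + 6 : ℤ[X]).eval n = ((24 : ℕ) : ℤ) := by
  simp only [eval_one, eval_mul, eval_add, eval_X, eval_sub, eval_ofNat, Nat.cast_ofNat]
  ring

/-- `n(n+2)(n+6) ≠ 0` for `n ≥ 1`. [this work] -/
theorem eval_twin_mul_add_six_ne_zero (n : ℕ) (hn : 1 ≤ n) :
    ((X * (X + 2) : ℤ[X]) * (X + 6)).eval (n : ℤ) ≠ 0 := by
  simp only [eval_mul, eval_add, eval_X, eval_ofNat]
  have h1 : (0 : ℤ) < n := by exact_mod_cast hn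
  positivity

/-- `(e, 24) = 1 ⟺ (e, 6) = 1`. [this work] -/
theorem coprime_twentyFour_iff (e : ℕ) : e.Coprime 24 ↔ e.Coprime 6 := by
  constructor
  · exact fun h => Nat.Coprime.coprime_dvd_right (by norm_num : 6 ∣ 24) h
  · exact fun h => Nat.Coprime.coprime_dvd_right (by norm_num : 24 ∣ 6 ^ 3) (h.pow_right 3)

/-- **Remark 20.11 (iv), the system `(X, X+2, X+6)` sliced along `X+6`.**  The slice
`(e, n+6) = 1`, `(e, 6) = 1` of the located window `∑_{n ≤ x} ∑_{e ∣ n(n+2)(n+6), e > y} μ(e) log³ e`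
is the pair window of `n(n+2)` over moduli prime to `6` with weight `log³`:
`∑_{n ≤ x} ∑_{e ∣ n(n+2), e > y, (e,6) = 1} μ(e) log³ e` (here `R = 24`). [this work] -/
theorem slice_twin_add_six (x y : ℕ) :
    ∑ n ∈ Icc 1 x, ∑ e ∈ ((((X * (X + 2) : ℤ[X]) * (X + 6)).eval (n : ℤ)).natAbs.divisors.filter
        fun e => y < e ∧ e.Coprime 6 ∧ e.Coprime (n + 6)), (μ e : ℝ) * Real.log e ^ 3
      = ∑ n ∈ Icc 1 x, ∑ e ∈ (((X * (X + 2) : ℤ[X]).eval (n : ℤ)).natAbs.divisors.filter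
        fun e => y < e ∧ e.Coprime 6), (μ e : ℝ) * Real.log e ^ 3 := by
  have hcol : ∀ n : ℤ, ∀ p : ℕ, p.Prime → (p : ℤ) ∣ (X * (X + 2) : ℤ[X]).eval n →
      (p : ℤ) ∣ (X + 6 : ℤ[X]).eval n → p ∣ 24 :=
    fun n p _ hG hH => primeCollision_of_bezout bezout_twin_add_six n p hG hH
  have h := tailSlice_eq hcol eval_twin_mul_add_six_ne_zero (fun e => y < e)
    (fun e => (μ e : ℝ) * Real.log e ^ 3) x
  have h6 : ∀ n : ℕ, ((X + 6 : ℤ[X]).eval (n : ℤ)).natAbs = n + 6 := by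
    intro n
    simp only [eval_add, eval_X, eval_ofNat]
    norm_cast
  have hL : ∀ n : ℕ, ((((X * (X + 2) : ℤ[X]) * (X + 6)).eval (n : ℤ)).natAbs.divisors.filter
        fun e => y < e ∧ e.Coprime 6 ∧ e.Coprime (n + 6))
      = ((((X * (X + 2) : ℤ[X]) * (X + 6)).eval (n : ℤ)).natAbs.divisors.filter
        fun e => y < e ∧ e.Coprime 24 ∧ e.Coprime ((X + 6 : ℤ[X]).eval (n : ℤ)).natAbs) := by
    intro n
    refine filter_congr fun e _ => ?_
    rw [h6 n, coprime_twentyFour_iff]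
  have hR : ∀ n : ℕ, (((X * (X + 2) : ℤ[X]).eval (n : ℤ)).natAbs.divisors.filter
        fun e => y < e ∧ e.Coprime 6)
      = (((X * (X + 2) : ℤ[X]).eval (n : ℤ)).natAbs.divisors.filter
        fun e => y < e ∧ e.Coprime 24) := by
    intro n
    refine filter_congr fun e _ => ?_
    rw [coprime_twentyFour_iff]
  simp_rw [hL, hR]
  exact h

end Summit.Parity.BatemanHorn.Theorems
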